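import Literature.NumberTheory.Adeles.IntegralAdelesReductionModN
import HarnessLib

/-!
# The NAMED residue homomorphism `integralAdeleResidue N : ẑ →+* ℤ/Nℤ` (the `ρ` of ★ `IntegralAdelesReductionModN`)

Topic `NumberTheory/Adeles`; namespace `Literature.NumberTheory.Adeles`.  ONE definition with a body and its API, everything
DERIVED from ★ `IntegralAdelesReductionModN` (A-p06, R60-55: `∃! ρ : ẑ →+* ℤ/Nℤ` with the residue property
`x − a ∈ N·ẑ → ρ x = a`, and all the `∀ ρ`-with-clause lemmas, incl. `GL_m(ẑ) → GL_m(ℤ/Nℤ)` and «`K_δ(N)` is the kernel of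
reduction on `K_δ(1) = GSp_δ(ẑ)`»); no named fact, no instance, no notation, no `sorry` (net Literature debt 0).  This file
only NAMES that `ρ` — `integralAdeleResidue N := (exists_ringHom_integralAdeles_zmod _).choose` for `[NeZero N]` — and restates
the ★ lemmas for the named hom with the clause discharged (`integralAdeleResidue_clause`), so that consumers (level structures
`η ↦ η ∘ γ̄`, `γ̄ = γ mod N`; cell hodgecm-mathlib `B-plan/M1PRIME-DAG.md` §5 D6 / Annex B H1) import ONE spelling; by uniqueness
(`eq_integralAdeleResidue_of_clause`) every other reduction hom IS this one.  Print: [Milne2005ShimuraVarieties] §6 p. 75 L5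
«`K(N) = {g ∈ G(𝔸_f) | g` preserves `V(ℤ̂)` and acts as `1` on `V(ℤ̂)/NV(ℤ̂)}`», §4 p. 42 «`Γ(N) = G(ℚ) ∩ {g ∈ GL_n(ℤ) | g ≡ I_n mod N}`»;
[Deligne1971TravauxShimura] Exemple 4.16 p. 150 «`K(N) = {g ∈ CSp(V̂_ℤ) | g ≡ 1 mod N}`».  HC_CM is proved only modulo the 7
printed citations until rung 0 closes; this file proves no cell binder.

## References
* [CasselsFrohlichANT1967] J. W. S. Cassels, A. Fröhlich (eds.), *Algebraic Number Theory* (1967), Ch. II §15 (`ẑ/Nẑ = ℤ/Nℤ`).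
* [Milne2005ShimuraVarieties] J. S. Milne, *Introduction to Shimura varieties* (2005; 2017 revision `paper:url-b0e8e4ca1c12`), §4 p. 42, §6 p. 75.
* [Deligne1971TravauxShimura] P. Deligne, *Travaux de Shimura*, Sém. Bourbaki 389 (1971), Exemple 4.16 p. 150.
-/

noncomputable section

open IsDedekindDomain NumberField
open Literature.AlgebraicGeometry.ModuliOfAbelianVarieties (finAdeleQ levelIdeal IsCongOne gspFinAdelic principalLevelSubgroup
  mem_principalLevelSubgroup_iff isIntegral_of_isCongOne_one)

namespace Literature.NumberTheory.Adeles

section Residue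

variable (N : ℕ) [NeZero N]

/-- **The residue homomorphism `ẑ → ℤ/Nℤ`** (`N ≠ 0`), NAMED: the reduction hom of ★ `exists_ringHom_integralAdeles_zmod`
(unique by ★ `ringHom_integralAdeles_zmod_unique`); `x ↦ a mod N` whenever `x ≡ a (mod N·ẑ)`.
[cite: CasselsFrohlichANT1967, Ch. II §15] [cite: Milne2005ShimuraVarieties, §6 p. 75] -/
def integralAdeleResidue : FiniteAdeleRing.integralAdeles (𝓞 ℚ) ℚ →+* ZMod N :=
  (exists_ringHom_integralAdeles_zmod (N := N) (NeZero.ne N)).choose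

/-- **The residue property** of the named hom: `x ≡ a (mod N·ẑ) → integralAdeleResidue N x = a` — the clause `hρ` every
`∀ ρ` lemma of ★ `IntegralAdelesReductionModN` asks for. [cite: CasselsFrohlichANT1967, Ch. II §15] -/
theorem integralAdeleResidue_clause :
    ∀ (x : FiniteAdeleRing.integralAdeles (𝓞 ℚ) ℚ) (a : ℤ),
      (x : finAdeleQ) - (a : finAdeleQ) ∈ levelIdeal N → integralAdeleResidue N x = a :=
  (exists_ringHom_integralAdeles_zmod (N := N) (NeZero.ne N)).choose_spec

/-- **Uniqueness**: any ring hom `ẑ → ℤ/Nℤ` with the residue property IS `integralAdeleResidue N`.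
[cite: CasselsFrohlichANT1967, Ch. II §15] -/
theorem eq_integralAdeleResidue_of_clause {ρ : FiniteAdeleRing.integralAdeles (𝓞 ℚ) ℚ →+* ZMod N}
    (hρ : ∀ (x : FiniteAdeleRing.integralAdeles (𝓞 ℚ) ℚ) (a : ℤ), (x : finAdeleQ) - (a : finAdeleQ) ∈ levelIdeal N → ρ x = a) :
    ρ = integralAdeleResidue N :=
  ringHom_integralAdeles_zmod_unique (NeZero.ne N) hρ (integralAdeleResidue_clause N)

/-- **Characterisation**: `integralAdeleResidue N x = a ↔ x ≡ a (mod N·ẑ)`. [cite: CasselsFrohlichANT1967, Ch. II §15] -/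
theorem integralAdeleResidue_eq_intCast_iff (x : FiniteAdeleRing.integralAdeles (𝓞 ℚ) ℚ) (a : ℤ) :
    integralAdeleResidue N x = a ↔ (x : finAdeleQ) - (a : finAdeleQ) ∈ levelIdeal N :=
  ringHom_integralAdeles_zmod_apply_eq_intCast_iff (NeZero.ne N) (integralAdeleResidue_clause N) x a

/-- **Kernel `= N·ẑ`**: `integralAdeleResidue N x = 0 ↔ x ∈ N·ẑ` («acts as `1` on `V(ℤ̂)/NV(ℤ̂)`» for `V = ℚ`).
[cite: Milne2005ShimuraVarieties, §6 p. 75] [cite: CasselsFrohlichANT1967, Ch. II §15] -/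
theorem integralAdeleResidue_eq_zero_iff (x : FiniteAdeleRing.integralAdeles (𝓞 ℚ) ℚ) :
    integralAdeleResidue N x = 0 ↔ (x : finAdeleQ) ∈ levelIdeal N :=
  ringHom_integralAdeles_zmod_apply_eq_zero_iff (NeZero.ne N) (integralAdeleResidue_clause N) x

/-- **Same residue ↔ congruent modulo `N·ẑ`.** [cite: CasselsFrohlichANT1967, Ch. II §15] -/
theorem integralAdeleResidue_eq_iff (x x' : FiniteAdeleRing.integralAdeles (𝓞 ℚ) ℚ) :
    integralAdeleResidue N x = integralAdeleResidue N x' ↔ (x : finAdeleQ) - (x' : finAdeleQ) ∈ levelIdeal N := by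
  rw [← sub_eq_zero, ← map_sub, integralAdeleResidue_eq_zero_iff, AddSubgroupClass.coe_sub]

/-- The residue of an integer is its class. [cite: CasselsFrohlichANT1967, Ch. II §15] -/
theorem integralAdeleResidue_intCast (a : ℤ) :
    integralAdeleResidue N ⟨(a : finAdeleQ), intCast_mem_integralAdeles a⟩ = a :=
  ringHom_integralAdeles_zmod_intCast (integralAdeleResidue_clause N) a

/-- The residue of a natural number is its class. [cite: CasselsFrohlichANT1967, Ch. II §15] -/
theorem integralAdeleResidue_natCast (n : ℕ) :
    integralAdeleResidue N ⟨(n : finAdeleQ), natCast_mem _ n⟩ = n :=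
  ringHom_integralAdeles_zmod_natCast (integralAdeleResidue_clause N) n

/-- **Surjectivity** `ẑ ↠ ℤ/Nℤ`. [cite: CasselsFrohlichANT1967, Ch. II §15] -/
theorem integralAdeleResidue_surjective : Function.Surjective (integralAdeleResidue N) :=
  ringHom_integralAdeles_zmod_surjective (integralAdeleResidue_clause N)

/-- **Change of level**: for `N′ ∣ N`, `(ℤ/Nℤ → ℤ/N′ℤ) ∘ integralAdeleResidue N = integralAdeleResidue N′`.
[cite: Deligne1971TravauxShimura, Exemple 4.16 p. 150] -/
theorem castHom_comp_integralAdeleResidue {N' : ℕ} [NeZero N'] (h : N' ∣ N) :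
    (ZMod.castHom h (ZMod N')).comp (integralAdeleResidue N) = integralAdeleResidue N' :=
  castHom_comp_ringHom_integralAdeles_zmod_eq (NeZero.ne N) h (integralAdeleResidue_clause N) (integralAdeleResidue_clause N')

end Residue

/-! ### Matrices and the principal levels, for the named hom -/

section Matrices

variable (N : ℕ) [NeZero N] {n : Type} [DecidableEq n]

/-- **`A ≡ 1 (mod N·ẑ) ↔ Ā = 1` in `M_n(ℤ/Nℤ)`** for a matrix `A` with entries in `ẑ` (★ `isCongOne_map_subtype_iff_map_eq_one`
for the named hom). [cite: Milne2005ShimuraVarieties, §6 p. 75 and §4 p. 42] [cite: Deligne1971TravauxShimura, Exemple 4.16 p. 150] -/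
theorem isCongOne_map_subtype_iff_map_integralAdeleResidue_eq_one (A : Matrix n n (FiniteAdeleRing.integralAdeles (𝓞 ℚ) ℚ)) :
    IsCongOne N (A.map (FiniteAdeleRing.integralAdeles (𝓞 ℚ) ℚ).subtype) ↔ A.map (integralAdeleResidue N) = 1 :=
  isCongOne_map_subtype_iff_map_eq_one (NeZero.ne N) (integralAdeleResidue_clause N) A

variable {g : ℕ} (δ : Fin g → ℕ)

/-- **`K_δ(N) = ker (K_δ(1) → GL_{2g}(ℤ/Nℤ))` read entrywise through the named hom**: for `γ ∈ K_δ(1) = GSp_δ(ẑ)`,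
`γ ∈ K_δ(N)` iff every entry of `γ` reduces to the corresponding entry of `1` (★ `mem_principalLevelSubgroup_iff_forall_ringHom_apply_eq`).
[cite: Deligne1971TravauxShimura, Exemple 4.16 p. 150] [cite: Milne2005ShimuraVarieties, §6 p. 75] -/
theorem mem_principalLevelSubgroup_iff_forall_integralAdeleResidue_eq {γ : gspFinAdelic δ}
    (hγ : γ ∈ principalLevelSubgroup δ 1) :
    γ ∈ principalLevelSubgroup δ N ↔
      ∀ i j : Fin g ⊕ Fin g,
        integralAdeleResidue N ⟨((γ : GL (Fin g ⊕ Fin g) finAdeleQ) : Matrix (Fin g ⊕ Fin g) (Fin g ⊕ Fin g) finAdeleQ) i j,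
            isIntegral_of_isCongOne_one ((mem_principalLevelSubgroup_iff δ).1 hγ).1 i j⟩ =
          (1 : Matrix (Fin g ⊕ Fin g) (Fin g ⊕ Fin g) (ZMod N)) i j :=
  mem_principalLevelSubgroup_iff_forall_ringHom_apply_eq δ (NeZero.ne N) (integralAdeleResidue_clause N) hγ

/-- **The reduction homomorphism `K_δ(1) → GL_{2g}(ℤ/Nℤ)` with entries `integralAdeleResidue N` and kernel `K_δ(N)`** exists
(★ `exists_monoidHom_principalLevelSubgroup_one_GL_zmod` for the named hom; surjectivity onto `Sp_δ`/`GSp_δ(ℤ/N)` not asserted).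
[cite: Deligne1971TravauxShimura, Exemple 4.16 p. 150] [cite: Milne2005ShimuraVarieties, §6 p. 75] -/
theorem exists_monoidHom_principalLevelSubgroup_one_integralAdeleResidue :
    ∃ φ : principalLevelSubgroup δ 1 →* GL (Fin g ⊕ Fin g) (ZMod N),
      (∀ (γ : principalLevelSubgroup δ 1) (i j : Fin g ⊕ Fin g)
          (h : (((γ : gspFinAdelic δ) : GL (Fin g ⊕ Fin g) finAdeleQ) : Matrix (Fin g ⊕ Fin g) (Fin g ⊕ Fin g) finAdeleQ) i j ∈
            FiniteAdeleRing.integralAdeles (𝓞 ℚ) ℚ),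
          ((φ γ : GL (Fin g ⊕ Fin g) (ZMod N)) : Matrix (Fin g ⊕ Fin g) (Fin g ⊕ Fin g) (ZMod N)) i j =
            integralAdeleResidue N ⟨_, h⟩) ∧
      ∀ γ : principalLevelSubgroup δ 1, φ γ = 1 ↔ (γ : gspFinAdelic δ) ∈ principalLevelSubgroup δ N :=
  exists_monoidHom_principalLevelSubgroup_one_GL_zmod δ (NeZero.ne N) (integralAdeleResidue_clause N)

end Matrices

end Literature.NumberTheory.Adeles

end
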